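import Summits.NavierStokesRegularity.NavierStokesRegularity.Theorems.TypeICertificateLadderTargetGaussianEnergyDeriv
import Literature.Analysis.FluidPDE.TaoEnstrophyLocalisationProofs
import Literature.Analysis.FluidPDE.LerayProfileCalculus
import Literature.Analysis.FluidPDE.TsaiLocalPressureSup
import HarnessLib

/-!
# Crux `NoTypeIBlowup` (stmt-NavierStokesRegularity-1217), line `head-flux-channel`:
  the GAUSSIAN BUDGET IDENTITY `D + E = ∫ |curl U|² G + ¼ ∫ ⟪y,U⟫² G` and the enstrophy form of
  the Gaussian energy identity (lead c1's census lemma for the open stub S4)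

Companion lead `prover-line-stmt-NavierStokesRegularity-1217-c1-0`, 2026-08-16. In the line's
Gaussian energy identity (S2c, landed: `stub_gaussianEnergyDeriv`)

  `E' = −D − E − ½ Ch`,  `E = ∫ ½‖U‖² G`, `D = ∫ |∇U|²_F G`, `Ch = ∫ (½‖U‖² + P)⟪y,U⟫ G`,

`G(y) = e^{−‖y‖²/4}`, the BUDGET `D + E` has a second, purely kinematic expression: for every
divergence-free `C²` field `V` on `ℝ³` with the rate-class bounds (`‖V‖ ≤ A`, `‖DV‖ ≤ B`),

  `∫ |DV|²_F G + ½ ∫ ‖V‖² G = ∫ ‖curl V‖² G + ¼ ∫ ⟪y, V⟫² G`            (`gaussianBudget_eq`).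

Proof: pointwise `|DV|²_F = ‖curl V‖² + tr (DV ∘ DV)` (tree:
`frobeniusNormSq_fderiv_eq_sq_norm_curl_add_trace`); `tr (DV ∘ DV) = div ((V·∇)V)` for
divergence-free `V` (tree: `divergence_convect_self_eq`); one integration by parts against the
Gaussian (`∇G = −½ y G`) gives `∫ tr (DV∘DV) G = ½ ∫ ⟪y, DV(V)⟫ G`, and
`⟪y, DV(y) V(y)⟫ = ∂_V ⟪y, V⟫ − ‖V‖²` with `∫ (∂_V ψ) G = ½ ∫ ψ² G` for the radial Reynolds scalar
`ψ = ⟪y, V⟫` (a second integration by parts, `div (G V) = −½ ψ G`), whence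
`∫ tr (DV∘DV) G = ¼ ∫ ψ² G − ½ ∫ ‖V‖² G` (`integral_traceCLM_comp_mul_gaussWeight`).

Consequence for the class (`gaussianEnergyDeriv_enstrophy_form`): along the Leray orbit
`U = lerayOrbit u` of a Type-I ancient mild field `u` (`IsTypeIAncientMild C u`) with a classical
pressure, the Gaussian energy obeys

  `E' = −( ∫ ‖curl U‖² G + ¼ ∫ ⟪y,U⟫² G ) − ½ Ch`,

i.e. the budget is GAUSSIAN ENSTROPHY plus one quarter of the Gaussian `L²`-mass of the radial
Reynolds scalar `ψ = ⟪y,U⟫` — the very factor through which the head enters the channel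
`Ch = ∫ (½‖U‖² + P) ψ G`. (So the open head-influx law S4 — kernel-checked equivalent to Type-I
Liouville in the rate class, `headInfluxLaw_iff_rateClassLiouville` — is implied by a
"head–enstrophy inequality" `avg ‖½‖U‖² + P − c_rad‖²_{L²(G)} ≤ 4(1−ε)² avg ‖curl U‖²_{L²(G)}`,
which is dimensionally an estimate only at small amplitude; recorded in the line's dead note.)
This is also the Gaussian average of the twisted-head equation
`(∂ₛ − Δ + (U+½y)·∇)(½‖U‖² + P + ½ψ) = −‖curl U‖² + ∂ₛP`, whose `∂ₛP` terms cancel on pairing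
with `G` (CAS: kit job j016309). Everything here is folklore calculus, fully proved; no
definitions. Lands `--supports stmt-NavierStokesRegularity-1217`.
-/

noncomputable section

-- the summit and its single sub-problem share the name (CONVENTIONS §1), as in every Theorems file
set_option linter.dupNamespace false

namespace Summit.NavierStokesRegularity.NavierStokesRegularity.Theorems.HeadFluxChannelBudget

open MeasureTheory Set Filter Topology Function InnerProductSpace
open scoped RealInnerProductSpace ContDiff
open Literature.Analysis Literature.Analysis.FluidPDE
open Literature.Analysis.FluidPDE.PineauVicol2026
open Summit.NavierStokesRegularity.NavierStokesRegularity.Theorems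
open Summit.NavierStokesRegularity.NavierStokesRegularity.Theorems.SymmetricScarExists.LogtimeBernoulli

variable {E : Type*} [NormedAddCommGroup E] [InnerProductSpace ℝ E] [FiniteDimensional ℝ E]
  [MeasurableSpace E] [BorelSpace E]

/-! ## The radial Reynolds scalar `ψ = ⟪y, V y⟫` -/

omit [FiniteDimensional ℝ E] [MeasurableSpace E] [BorelSpace E] in
/-- `∂ᵥ ⟪y, V y⟫ = ⟪y, DV(y) v⟫ + ⟪v, V y⟫` for a differentiable field. [folklore] -/
theorem fderiv_inner_id_apply {V : E → E} {y : E} (hV : DifferentiableAt ℝ V y) (v : E) :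
    fderiv ℝ (fun z => ⟪z, V z⟫) y v = ⟪y, fderiv ℝ V y v⟫ + ⟪v, V y⟫ := by
  have e : (fun z : E => ⟪z, V z⟫) = fun t => ⟪id t, V t⟫ := rfl
  rw [e, fderiv_inner_apply ℝ differentiableAt_id hV, fderiv_id]
  rfl

omit [FiniteDimensional ℝ E] [MeasurableSpace E] [BorelSpace E] in
/-- `⟪y, DV(y) V(y)⟫ = ∂_{V} ⟪y, V⟫ (y) − ‖V y‖²`. [folklore] -/
theorem inner_fderiv_apply_self_eq {V : E → E} {y : E} (hV : DifferentiableAt ℝ V y) :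
    ⟪y, fderiv ℝ V y (V y)⟫ = fderiv ℝ (fun z => ⟪z, V z⟫) y (V y) - ‖V y‖ ^ 2 := by
  rw [fderiv_inner_id_apply hV, real_inner_self_eq_norm_sq]
  ring

/-- **`∫ (∂_V ψ) G = ½ ∫ ψ² G`** for the radial Reynolds scalar `ψ = ⟪y, V⟫` of a bounded
divergence-free `C¹` field with bounded gradient (`div (G V) = −½ ψ G`). [folklore] -/
theorem integral_fderiv_inner_id_apply_mul_gaussWeight {V : E → E} (hV : ContDiff ℝ 1 V)
    (hdiv : VectorCalculus.IsDivFree V) {A B : ℝ}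
    (hA : ∀ y, ‖V y‖ ≤ A) (h1 : ∀ y, ‖fderiv ℝ V y‖ ≤ B) :
    ∫ y, fderiv ℝ (fun z => ⟪z, V z⟫) y (V y) * gaussWeight y =
      (1 / 2 : ℝ) * ∫ y, ⟪y, V y⟫ ^ 2 * gaussWeight y := by
  haveI : CompleteSpace E := FiniteDimensional.complete ℝ E
  have hA0 : 0 ≤ A := (norm_nonneg _).trans (hA 0)
  have hB0 : 0 ≤ B := (norm_nonneg _).trans (h1 0)
  have hg0 : ∀ y : E, 0 ≤ gaussWeight y := fun y => (gaussWeight_pos y).le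
  have cV : Continuous V := hV.continuous
  have hVd : Differentiable ℝ V := hV.differentiable one_ne_zero
  have hψ : ContDiff ℝ 1 fun z => ⟪z, V z⟫ := contDiff_id.inner ℝ hV
  have hu : ContDiff ℝ 1 fun y => gaussWeight y • V y := (contDiff_gaussWeight (n := 1)).smul hV
  have hψb : ∀ y, |⟪y, V y⟫| ≤ A * (1 + ‖y‖) := fun y =>
    (abs_real_inner_le_norm _ _).trans (by nlinarith [hA y, norm_nonneg y, norm_nonneg (V y)])
  -- the pointwise form of the two integrands of the integration by parts
  have hdivg : ∀ y, ⟪y, V y⟫ * VectorCalculus.divergence (fun z => gaussWeight z • V z) y =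
      (-(1 / 2 : ℝ)) * (⟪y, V y⟫ ^ 2 * gaussWeight y) := by
    intro y; rw [divergence_gaussWeight_smul hV hdiv y]; ring
  have hgr : ∀ y, ⟪gaussWeight y • V y, gradient (fun z => ⟪z, V z⟫) y⟫ =
      fderiv ℝ (fun z => ⟪z, V z⟫) y (V y) * gaussWeight y := by
    intro y
    rw [real_inner_comm, inner_gradient_left, map_smul, smul_eq_mul, mul_comm]
  -- integrability
  have iG : Integrable fun y => ⟪y, V y⟫ ^ 2 * gaussWeight y := by
    refine integrable_of_norm_le_mul_gaussWeight (M := A ^ 2)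
      ((((continuous_id.inner cV).pow 2).mul continuous_gaussWeight).aestronglyMeasurable) 2
      fun y => ?_
    rw [norm_mul, Real.norm_of_nonneg (hg0 y), Real.norm_of_nonneg (sq_nonneg _)]
    refine mul_le_mul_of_nonneg_right ?_ (hg0 y)
    calc ⟪y, V y⟫ ^ 2 = |⟪y, V y⟫| ^ 2 := (sq_abs _).symm
      _ ≤ (A * (1 + ‖y‖)) ^ 2 := pow_le_pow_left₀ (abs_nonneg _) (hψb y) 2
      _ = A ^ 2 * (1 + ‖y‖) ^ 2 := by ring
  have iF : Integrable fun y => fderiv ℝ (fun z => ⟪z, V z⟫) y (V y) * gaussWeight y := by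
    refine integrable_of_norm_le_mul_gaussWeight (M := A * B + A ^ 2) ?_ 1 fun y => ?_
    · exact (((hψ.continuous_fderiv one_ne_zero).clm_apply cV).mul
        continuous_gaussWeight).aestronglyMeasurable
    · rw [norm_mul, Real.norm_of_nonneg (hg0 y), fderiv_inner_id_apply (hVd y),
        real_inner_self_eq_norm_sq, Real.norm_eq_abs]
      refine mul_le_mul_of_nonneg_right ?_ (hg0 y)
      have e1 : |⟪y, fderiv ℝ V y (V y)⟫| ≤ ‖y‖ * (B * A) :=
        (abs_real_inner_le_norm _ _).trans (mul_le_mul_of_nonneg_left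
          ((ContinuousLinearMap.le_opNorm _ _).trans
            (mul_le_mul (h1 y) (hA y) (norm_nonneg _) hB0)) (norm_nonneg _))
      have e2 : |‖V y‖ ^ 2| ≤ A ^ 2 := by
        rw [abs_of_nonneg (sq_nonneg _)]; exact pow_le_pow_left₀ (norm_nonneg _) (hA y) 2
      calc |⟪y, fderiv ℝ V y (V y)⟫ + ‖V y‖ ^ 2|
          ≤ |⟪y, fderiv ℝ V y (V y)⟫| + |‖V y‖ ^ 2| := abs_add_le _ _
        _ ≤ ‖y‖ * (B * A) + A ^ 2 := add_le_add e1 e2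
        _ ≤ (A * B + A ^ 2) * (1 + ‖y‖) ^ 1 := by
            rw [pow_one]; nlinarith [norm_nonneg y, mul_nonneg hA0 hB0, sq_nonneg A]
  have hint : Integrable fun y => ⟪y, V y⟫ • (gaussWeight y • V y) := by
    refine integrable_of_norm_le_mul_gaussWeight (M := A * A) ?_ 1 ?_
    · exact ((continuous_id.inner cV).smul (continuous_gaussWeight.smul cV)).aestronglyMeasurable
    · intro y
      rw [norm_smul, norm_smul, Real.norm_of_nonneg (hg0 y), Real.norm_eq_abs, pow_one]
      calc |⟪y, V y⟫| * (gaussWeight y * ‖V y‖) ≤ A * (1 + ‖y‖) * (gaussWeight y * A) :=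
            mul_le_mul (hψb y) (mul_le_mul_of_nonneg_left (hA y) (hg0 y))
              (mul_nonneg (hg0 y) (norm_nonneg _)) (mul_nonneg hA0 (by positivity))
        _ = A * A * (1 + ‖y‖) * gaussWeight y := by ring
  have h₁ : Integrable fun y =>
      ⟪y, V y⟫ * VectorCalculus.divergence (fun z => gaussWeight z • V z) y := by
    simp_rw [hdivg]; exact iG.const_mul _
  have h₂ : Integrable fun y => ⟪gaussWeight y • V y, gradient (fun z => ⟪z, V z⟫) y⟫ := by
    simp_rw [hgr]; exact iF
  have key := integral_mul_divergence_add_eq_zero_of_integrable hψ hu hint h₁ h₂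
  simp_rw [hdivg, hgr] at key
  rw [integral_const_mul] at key
  linarith

/-! ## `∫ tr (DV ∘ DV) G = ¼ ∫ ψ² G − ½ ∫ ‖V‖² G` -/

/-- **The trace term against the Gaussian.** For a divergence-free `C²` field `V` with
`‖V‖ ≤ A`, `‖DV‖ ≤ B`: `∫ tr (DV∘DV) G = ¼ ∫ ⟪y,V⟫² G − ½ ∫ ‖V‖² G`
(`tr (DV∘DV) = div ((V·∇)V)`, one integration by parts with `∇G = −½ y G`, then
`integral_fderiv_inner_id_apply_mul_gaussWeight`). [folklore] -/
theorem integral_traceCLM_comp_mul_gaussWeight {V : E → E} (hV : ContDiff ℝ 2 V)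
    (hdiv : VectorCalculus.IsDivFree V) {A B : ℝ}
    (hA : ∀ y, ‖V y‖ ≤ A) (h1 : ∀ y, ‖fderiv ℝ V y‖ ≤ B) :
    ∫ y, traceCLM ((fderiv ℝ V y).comp (fderiv ℝ V y)) * gaussWeight y =
      (1 / 4 : ℝ) * (∫ y, ⟪y, V y⟫ ^ 2 * gaussWeight y) -
        (1 / 2 : ℝ) * ∫ y, ‖V y‖ ^ 2 * gaussWeight y := by
  haveI : CompleteSpace E := FiniteDimensional.complete ℝ E
  have hV1 : ContDiff ℝ 1 V := hV.of_le one_le_two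
  have hA0 : 0 ≤ A := (norm_nonneg _).trans (hA 0)
  have hB0 : 0 ≤ B := (norm_nonneg _).trans (h1 0)
  have hg0 : ∀ y : E, 0 ≤ gaussWeight y := fun y => (gaussWeight_pos y).le
  have cV : Continuous V := hV.continuous
  have hVd : Differentiable ℝ V := hV1.differentiable one_ne_zero
  have cDV : Continuous (fderiv ℝ V) := hV.continuous_fderiv two_ne_zero
  have hD : ContDiff ℝ 1 (fderiv ℝ V) := hV.fderiv_right (m := 1) le_rfl
  -- `(V·∇)V` is `C¹`, bounded by `B A`
  have hW : ContDiff ℝ 1 (convect V V) := by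
    have e : convect V V = fun x => fderiv ℝ V x (V x) := rfl
    rw [e]; exact hD.clm_apply hV1
  have hWb : ∀ y, ‖convect V V y‖ ≤ B * A := fun y =>
    (ContinuousLinearMap.le_opNorm _ _).trans (mul_le_mul (h1 y) (hA y) (norm_nonneg _) hB0)
  have cW : Continuous (convect V V) := hW.continuous
  -- the divergence of `(V·∇)V` is the trace term, bounded by `‖tr‖ B²`
  have hdivW : ∀ y, VectorCalculus.divergence (convect V V) y =
      traceCLM ((fderiv ℝ V y).comp (fderiv ℝ V y)) := divergence_convect_self_eq hV hdiv
  set T : ℝ := ‖(traceCLM : (E →L[ℝ] E) →L[ℝ] ℝ)‖ with hT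
  have htrb : ∀ y, |traceCLM ((fderiv ℝ V y).comp (fderiv ℝ V y))| ≤ T * B ^ 2 := by
    intro y
    refine (abs_traceCLM_le _).trans (mul_le_mul_of_nonneg_left ?_
      (norm_nonneg (traceCLM : (E →L[ℝ] E) →L[ℝ] ℝ)))
    calc ‖(fderiv ℝ V y).comp (fderiv ℝ V y)‖ ≤ ‖fderiv ℝ V y‖ * ‖fderiv ℝ V y‖ :=
          ContinuousLinearMap.opNorm_comp_le _ _
      _ ≤ B * B := mul_le_mul (h1 y) (h1 y) (norm_nonneg _) hB0
      _ = B ^ 2 := (sq B).symm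
  -- pointwise forms of the two integrands of the integration by parts (θ = G, u = (V·∇)V)
  have hθdiv : ∀ y, gaussWeight y * VectorCalculus.divergence (convect V V) y =
      traceCLM ((fderiv ℝ V y).comp (fderiv ℝ V y)) * gaussWeight y := by
    intro y; rw [hdivW y, mul_comm]
  have hgr : ∀ y, ⟪convect V V y, gradient gaussWeight y⟫ =
      (-(1 / 2 : ℝ)) * (⟪y, fderiv ℝ V y (V y)⟫ * gaussWeight y) := by
    intro y
    rw [gradient_gaussWeight, real_inner_smul_right, convect_apply, real_inner_comm]
    ring
  -- integrability
  have iTr : Integrable fun y => traceCLM ((fderiv ℝ V y).comp (fderiv ℝ V y)) * gaussWeight y := by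
    refine integrable_of_norm_le_const_mul_gaussWeight (M := T * B ^ 2) ?_ fun y => ?_
    · have c1 : Continuous fun y => traceCLM ((fderiv ℝ V y).comp (fderiv ℝ V y)) :=
        (traceCLM : (E →L[ℝ] E) →L[ℝ] ℝ).continuous.comp (cDV.clm_comp cDV)
      exact (c1.mul continuous_gaussWeight).aestronglyMeasurable
    · rw [norm_mul, Real.norm_of_nonneg (hg0 y), Real.norm_eq_abs]
      exact mul_le_mul_of_nonneg_right (htrb y) (hg0 y)
  have iY : Integrable fun y => ⟪y, fderiv ℝ V y (V y)⟫ * gaussWeight y := by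
    refine integrable_of_norm_le_mul_gaussWeight (M := B * A) ?_ 1 fun y => ?_
    · exact ((continuous_id.inner (cDV.clm_apply cV)).mul continuous_gaussWeight).aestronglyMeasurable
    · rw [norm_mul, Real.norm_of_nonneg (hg0 y), Real.norm_eq_abs, pow_one]
      refine mul_le_mul_of_nonneg_right ((abs_real_inner_le_norm _ _).trans ?_) (hg0 y)
      calc ‖y‖ * ‖fderiv ℝ V y (V y)‖ ≤ (1 + ‖y‖) * (B * A) :=
            mul_le_mul (by linarith [norm_nonneg y]) (hWb y) (norm_nonneg _) (by positivity)
        _ = B * A * (1 + ‖y‖) := by ring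
  have hint : Integrable fun y => gaussWeight y • convect V V y := by
    refine integrable_of_norm_le_const_mul_gaussWeight (M := B * A)
      ((continuous_gaussWeight.smul cW).aestronglyMeasurable) fun y => ?_
    rw [norm_smul, Real.norm_of_nonneg (hg0 y), mul_comm]
    exact mul_le_mul_of_nonneg_right (hWb y) (hg0 y)
  have h₁ : Integrable fun y => gaussWeight y * VectorCalculus.divergence (convect V V) y := by
    simp_rw [hθdiv]; exact iTr
  have h₂ : Integrable fun y => ⟪convect V V y, gradient gaussWeight y⟫ := by
    simp_rw [hgr]; exact iY.const_mul _
  have key := integral_mul_divergence_add_eq_zero_of_integrable (contDiff_gaussWeight (n := 1))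
    hW hint h₁ h₂
  simp_rw [hθdiv, hgr] at key
  rw [integral_const_mul] at key
  -- `∫ ⟪y, DV(V)⟫ G = ½ ∫ ψ² G − ∫ ‖V‖² G`
  have iF : Integrable fun y => fderiv ℝ (fun z => ⟪z, V z⟫) y (V y) * gaussWeight y := by
    refine (iY.add (integrable_norm_sq_mul_gaussWeight' cV hA)).congr
      (Eventually.of_forall fun y => ?_)
    show ⟪y, fderiv ℝ V y (V y)⟫ * gaussWeight y + ‖V y‖ ^ 2 * gaussWeight y =
      fderiv ℝ (fun z => ⟪z, V z⟫) y (V y) * gaussWeight y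
    rw [inner_fderiv_apply_self_eq (hVd y)]; ring
  have hsplit : ∫ y, ⟪y, fderiv ℝ V y (V y)⟫ * gaussWeight y =
      (∫ y, fderiv ℝ (fun z => ⟪z, V z⟫) y (V y) * gaussWeight y) -
        ∫ y, ‖V y‖ ^ 2 * gaussWeight y := by
    rw [← integral_sub iF (integrable_norm_sq_mul_gaussWeight' cV hA)]
    refine integral_congr_ae (Eventually.of_forall fun y => ?_)
    show ⟪y, fderiv ℝ V y (V y)⟫ * gaussWeight y =
      fderiv ℝ (fun z => ⟪z, V z⟫) y (V y) * gaussWeight y - ‖V y‖ ^ 2 * gaussWeight y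
    rw [inner_fderiv_apply_self_eq (hVd y)]; ring
  rw [hsplit, integral_fderiv_inner_id_apply_mul_gaussWeight hV1 hdiv hA h1] at key
  linarith

end Summit.NavierStokesRegularity.NavierStokesRegularity.Theorems.HeadFluxChannelBudget

/-! ## The budget identity on `ℝ³` and its consequence for the class -/

namespace Summit.NavierStokesRegularity.NavierStokesRegularity.Theorems

open MeasureTheory Set Filter Topology Function
open scoped RealInnerProductSpace ContDiff
open Literature.Analysis Literature.Analysis.FluidPDE
open Literature.Analysis.FluidPDE.PineauVicol2026
open Summit.NavierStokesRegularity.NavierStokesRegularity.Theorems.SymmetricScarExists.LogtimeBernoulli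

/-- **Gaussian budget identity** (kinematic). For a divergence-free `C²` field `V : ℝ³ → ℝ³`
with `‖V‖ ≤ A` and `‖DV‖ ≤ B`, and `G(y) = e^{−‖y‖²/4}`:
`∫ |DV|²_F G + ∫ ½‖V‖² G = ∫ ‖curl V‖² G + ¼ ∫ ⟪y, V⟫² G` — the Gaussian dissipation-plus-energy
budget of the line's identity (GE) equals Gaussian ENSTROPHY plus a quarter of the Gaussian
`L²`-mass of the radial Reynolds scalar `⟪y, V⟫`. (Pointwise `|DV|²_F = ‖curl V‖² + tr(DV∘DV)`
and `HeadFluxChannelBudget.integral_traceCLM_comp_mul_gaussWeight`.) [folklore] -/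
theorem gaussianBudget_eq {V : EuclideanSpace ℝ (Fin 3) → EuclideanSpace ℝ (Fin 3)}
    (hV : ContDiff ℝ 2 V) (hdiv : VectorCalculus.IsDivFree V) {A B : ℝ}
    (hA : ∀ y, ‖V y‖ ≤ A) (h1 : ∀ y, ‖fderiv ℝ V y‖ ≤ B) :
    (∫ y, frobeniusNormSq (fderiv ℝ V y) * Real.exp (-‖y‖ ^ 2 / 4)) +
        ∫ y, ‖V y‖ ^ 2 / 2 * Real.exp (-‖y‖ ^ 2 / 4) =
      (∫ y, ‖curl V y‖ ^ 2 * Real.exp (-‖y‖ ^ 2 / 4)) +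
        (1 / 4 : ℝ) * ∫ y, ⟪y, V y⟫ ^ 2 * Real.exp (-‖y‖ ^ 2 / 4) := by
  have hg : ∀ y : EuclideanSpace ℝ (Fin 3), Real.exp (-‖y‖ ^ 2 / 4) = gaussWeight y := fun y => rfl
  simp_rw [hg]
  have hB0 : 0 ≤ B := (norm_nonneg _).trans (h1 0)
  have hg0 : ∀ y : EuclideanSpace ℝ (Fin 3), 0 ≤ gaussWeight y := fun y => (gaussWeight_pos y).le
  have cDV : Continuous (fderiv ℝ V) := hV.continuous_fderiv two_ne_zero
  -- integrability of the Frobenius term (`|DV|²_F ≤ 3 ‖DV‖²`)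
  have iFr : Integrable fun y => frobeniusNormSq (fderiv ℝ V y) * gaussWeight y := by
    refine integrable_of_norm_le_const_mul_gaussWeight
      (M := Module.finrank ℝ (EuclideanSpace ℝ (Fin 3)) * B ^ 2) ?_ fun y => ?_
    · exact ((continuous_frobeniusNormSq.comp cDV).mul continuous_gaussWeight).aestronglyMeasurable
    · rw [norm_mul, Real.norm_of_nonneg (hg0 y), Real.norm_of_nonneg (frobeniusNormSq_nonneg _)]
      refine mul_le_mul_of_nonneg_right ((frobeniusNormSq_le_finrank_mul _).trans ?_) (hg0 y)
      exact mul_le_mul_of_nonneg_left (pow_le_pow_left₀ (norm_nonneg _) (h1 y) 2) (by positivity)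
  -- the trace term and its integral
  have htr := HeadFluxChannelBudget.integral_traceCLM_comp_mul_gaussWeight hV hdiv hA h1
  have iTr : Integrable fun y =>
      traceCLM ((fderiv ℝ V y).comp (fderiv ℝ V y)) * gaussWeight y := by
    refine integrable_of_norm_le_const_mul_gaussWeight
      (M := ‖(traceCLM : (EuclideanSpace ℝ (Fin 3) →L[ℝ] EuclideanSpace ℝ (Fin 3)) →L[ℝ] ℝ)‖ *
        B ^ 2) ?_ fun y => ?_
    · exact (((traceCLM : (EuclideanSpace ℝ (Fin 3) →L[ℝ] EuclideanSpace ℝ (Fin 3)) →L[ℝ] ℝ)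
        |>.continuous.comp (cDV.clm_comp cDV)).mul continuous_gaussWeight).aestronglyMeasurable
    · rw [norm_mul, Real.norm_of_nonneg (hg0 y), Real.norm_eq_abs]
      refine mul_le_mul_of_nonneg_right ((abs_traceCLM_le _).trans
        (mul_le_mul_of_nonneg_left ?_ (norm_nonneg
          (traceCLM : (EuclideanSpace ℝ (Fin 3) →L[ℝ] EuclideanSpace ℝ (Fin 3)) →L[ℝ] ℝ)))) (hg0 y)
      calc ‖(fderiv ℝ V y).comp (fderiv ℝ V y)‖ ≤ ‖fderiv ℝ V y‖ * ‖fderiv ℝ V y‖ :=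
            ContinuousLinearMap.opNorm_comp_le _ _
        _ ≤ B * B := mul_le_mul (h1 y) (h1 y) (norm_nonneg _) hB0
        _ = B ^ 2 := (sq B).symm
  -- the curl term as the difference `|DV|²_F G − tr(DV∘DV) G`
  have hcurl : ∀ y, ‖curl V y‖ ^ 2 * gaussWeight y =
      frobeniusNormSq (fderiv ℝ V y) * gaussWeight y -
        traceCLM ((fderiv ℝ V y).comp (fderiv ℝ V y)) * gaussWeight y := by
    intro y
    rw [frobeniusNormSq_fderiv_eq_sq_norm_curl_add_trace V y]; ring
  have hIcurl : ∫ y, ‖curl V y‖ ^ 2 * gaussWeight y =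
      (∫ y, frobeniusNormSq (fderiv ℝ V y) * gaussWeight y) -
        ∫ y, traceCLM ((fderiv ℝ V y).comp (fderiv ℝ V y)) * gaussWeight y := by
    rw [← integral_sub iFr iTr]
    exact integral_congr_ae (Eventually.of_forall hcurl)
  -- `∫ ½‖V‖² G = ½ ∫ ‖V‖² G`
  have hE : ∫ y, ‖V y‖ ^ 2 / 2 * gaussWeight y = (1 / 2 : ℝ) * ∫ y, ‖V y‖ ^ 2 * gaussWeight y := by
    rw [← integral_const_mul]
    exact integral_congr_ae (Eventually.of_forall fun y => by ring)
  rw [hIcurl, htr, hE]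
  ring

/-- **The Gaussian energy identity in ENSTROPHY FORM** (line `head-flux-channel`, consequence of
the landed S2c `stub_gaussianEnergyDeriv` and the kinematic `gaussianBudget_eq`): along the Leray
orbit `U = lerayOrbit u` of a Type-I ancient mild field `u` (`IsTypeIAncientMild C u`) with a
classical pressure `p` on `(−∞,0)`, `P = lerayOrbitPressure p`, `G = e^{−‖y‖²/4}`, the Gaussian
energy `E(s) = ∫ ½‖U‖² G` satisfies
`E' = −( ∫ ‖curl U‖² G + ¼ ∫ ⟪y,U⟫² G ) − ½ ∫ (½‖U‖² + P)⟪y,U⟫ G`: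
the budget is Gaussian enstrophy plus a quarter of the Gaussian `L²`-mass of the radial Reynolds
scalar `⟪y,U⟫`, the factor through which the head enters the channel. (Equivalently: the
Gaussian average of the twisted-head equation `(∂ₛ − Δ + (U+½y)·∇)(½‖U‖²+P+½⟪y,U⟫) = −‖curl U‖² + ∂ₛP`,
in which the `∂ₛP` terms cancel.) [folklore composition] -/
theorem gaussianEnergyDeriv_enstrophy_form :
    ∀ (C : ℝ) (u : ℝ → EuclideanSpace ℝ (Fin 3) → EuclideanSpace ℝ (Fin 3)) (p : ℝ → EuclideanSpace ℝ (Fin 3) → ℝ), Literature.Analysis.FluidPDE.IsTypeIAncientMild C u → Literature.Analysis.FluidPDE.IsClassicalNSSolutionOn (Set.Iio 0) 1 0 u p → ∀ s : ℝ, HasDerivAt (fun σ : ℝ => ∫ y, ‖Literature.Analysis.FluidPDE.lerayOrbit u σ y‖ ^ 2 / 2 * Real.exp (-‖y‖ ^ 2 / 4)) (-((∫ y, ‖Literature.Analysis.FluidPDE.curl (Literature.Analysis.FluidPDE.lerayOrbit u s) y‖ ^ 2 * Real.exp (-‖y‖ ^ 2 / 4)) + (1 / 4 : ℝ) * ∫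 y, inner ℝ y (Literature.Analysis.FluidPDE.lerayOrbit u s y) ^ 2 * Real.exp (-‖y‖ ^ 2 / 4)) - (∫ y, (‖Literature.Analysis.FluidPDE.lerayOrbit u s y‖ ^ 2 / 2 + Literature.Analysis.FluidPDE.lerayOrbitPressure p s y) * inner ℝ y (Literature.Analysis.FluidPDE.lerayOrbit u s y) * Real.exp (-‖y‖ ^ 2 / 4)) / 2) s := by
  intro C u p hu hp s
  have hBL := isClassicalNSSolutionOn_Iio_iff_isBackwardLeraySolutionOn.1 hp
  have hV : ContDiff ℝ 2 (lerayOrbit u s) :=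
    (hBL.contDiff_velocity (mem_univ s)).of_le (by norm_cast)
  have hdiv : VectorCalculus.IsDivFree (lerayOrbit u s) := hBL.divFree s (mem_univ s)
  have hUC : ∀ σ y, ‖lerayOrbit u σ y‖ ≤ C := headFlux_norm_lerayOrbit_le hu
  obtain ⟨K₀, hK₀⟩ := HeadFluxChannelS2a.exists_norm_fderiv_lerayOrbit_le C
  have hbud := gaussianBudget_eq hV hdiv (hUC s) (hK₀ hu s)
  refine (stub_gaussianEnergyDeriv C u p hu hp s).congr_deriv ?_
  linarith

end Summit.NavierStokesRegularity.NavierStokesRegularity.Theorems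

end
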